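import Mathlib
import HarnessLib
import HarnessLib.Audit
import Summits.QuantumFields.Statement
import Summits.QuantumFields.YangMills.Theorems.WeakCouplingRates
import Literature.MathematicalPhysics.QuantumLattice.GaugeGroups
import HarnessLib.Audit.Status.Attr

/-!
Route: XiPowWidening

CLOSED (superseded) 2026-08-28T02:14:24Z by planner-ym-idea-1-g3-0 — reason: superseded:route-QuantumFields-ColdBoxAllGroups — superseded by route-QuantumFields-ColdBoxAllGroups — note: target leaf XiPow (R2xi-G) is PROVED in tree by Summit.QuantumFields.YangMills.Theorems.WeakCouplingRates.xiPow_holds (Theorems/ColdBoxAllGroupsXiPow.lean, route ColdBoxAllGroups); a re-point to an all-G super-polynomial rung is not reachable by this route's widening lever (rigidity precision beta^-. The file is kept as the record of this route; refuted decls are indexed as negative knowledge (`ledger negatives`).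

# Route XiPowWidening — Widen SU(2) to every compact simple G: gap <= beta^(-eps) (leaf XiPow) from
a Lie-algebra-generic witness state plus state-space rigidity

RUNG-WIDENING LINE (D-0145 ideator seat ym-idea-1, technique card «restrict-then-tighten»; bears_on
LADDER-YM rung R2ξ in its
all-groups form: it closes the EXISTING OPEN leaf
`Summit.QuantumFields.YangMills.Theorems.WeakCouplingRates.XiPow` («for every compact
simple G and faithful unitary lattice representation r there is ε > 0 with RP-spectral mass gap ≤
β^(−ε) for every 4-d torus-limit state,
β ≥ β₀»; Theorems/WeakCouplingRates.lean §6, `xiPowSU2_of_xiPow` proved) — NOT the summit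
`YangMills`, not the Clay gap (an UPPER bound on
the gap), and no summit is proved by this line). The RESTRICTED CLASS is done: G = SU(2) is the leaf
`XiPowSU2`, PROVED in the tree
(`xiPowSU2_holds`, route WeakCouplingRates: BOX ∧ BULK ∧ FLOOR). The WIDENING: it suffices to show X
= RIGIDITY(G) ∧ WITNESS(G) for every
compact simple G and every r, two statements about the convex set 𝒢_inv(β) of translation-invariant
DLR probability states of the Wilson
theory on ℤ⁴ (no volume parameter, no chart of G anywhere in the statements): (RIGIDITY) any two
states of 𝒢_inv(β) have the same
connected (1,2)-plaquette-cost time correlator `rpCorr μ (plaqCost0 r.ρ 1 2) n` at every 1 ≤ n ≤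
2β^A up to C·n^q·β^(−a), a > 2;
(WITNESS) for every large β and every such n SOME state of 𝒢_inv(β) has the free-gluon-size floor
κ·β^(−2)·n^(−p). Torus limit points lie
in 𝒢_inv(β) (support), so every limit point inherits the floor (support, arithmetic), and the WCR
kernel (`HasRPTimeGap.le_log_div`, then
log β/β^A ≤ β^(−A/2)) gives `∃ ε > 0, MassGapPowerDecayOf 4 r.ρ ε` per (G, r) (support), i.e.
`XiPow`. Card: bootstrap-rigidity-witness-xipow
(same lever; the SU(2) instance of this route, filed 20:30Z as BootstrapRigidity against the
already-proved leaf, is withdrawn).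
Lean: `∀ (G : Type) [Group G] [TopologicalSpace G] [IsTopologicalGroup G] [CompactSpace G],
Literature.MathematicalPhysics.QuantumFieldTheory.IsCompactSimpleLieGroup G → letI : MeasurableSpace
G := borel G; haveI : BorelSpace G := ⟨rfl⟩; ∀ r :
Literature.MathematicalPhysics.QuantumFieldTheory.LatticeRep G, (∃ A C β₀ a : ℝ, ∃ q : ℕ, 0 < A ∧ 2
< a ∧ ∀ β : ℝ, β₀ ≤ β → ∀ μ ν : MeasureTheory.Measure
(Literature.MathematicalPhysics.QuantumLattice.LGConfig 4 G), μ ∈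
Literature.MathematicalPhysics.QuantumLattice.ymGibbsMeasures (d := 4) r.ρ β → ν ∈
Literature.MathematicalPhysics.QuantumLattice.ymGibbsMeasures (d := 4) r.ρ β →
MeasureTheory.IsProbabilityMeasure μ → MeasureTheory.IsProbabilityMeasure ν →
Literature.MathematicalPhysics.QuantumLattice.IsZdTranslationInvariant μ →
Literature.MathematicalPhysics.QuantumLattice.IsZdTranslationInvariant ν → ∀ n : ℕ, 1 ≤ n → (n : ℝ)
≤ 2 * β ^ A → |Summit.QuantumFields.YangMills.Theorems.WeakCouplingRates.rpCorr μ
(Summit.QuantumFields.YangMills.Theorems.WeakCouplingRates.plaqCost0 r.ρ (1 : Fin 4) 2) n -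
Summit.QuantumFields.YangMills.Theorems.WeakCouplingRates.rpCorr ν
(Summit.QuantumFields.YangMills.Theorems.WeakCouplingRates.plaqCost0 r.ρ (1 : Fin 4) 2) n| ≤ C * (n
: ℝ) ^ q * β ^ (-a)) ∧ (∃ A κ β₀ : ℝ, ∃ p : ℕ, 0 < A ∧ 0 < κ ∧ ∀ β : ℝ, β₀ ≤ β → ∀ n : ℕ, 1 ≤ n → (n
: ℝ) ≤ 2 * β ^ A → ∃ ν : MeasureTheory.Measure
(Literature.MathematicalPhysics.QuantumLattice.LGConfig 4 G), ν ∈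
Literature.MathematicalPhysics.QuantumLattice.ymGibbsMeasures (d := 4) r.ρ β ∧
MeasureTheory.IsProbabilityMeasure ν ∧
Literature.MathematicalPhysics.QuantumLattice.IsZdTranslationInvariant ν ∧ κ * β ^ (-(2 : ℝ)) / (n :
ℝ) ^ p ≤ Summit.QuantumFields.YangMills.Theorems.WeakCouplingRates.rpCorr ν
(Summit.QuantumFields.YangMills.Theorems.WeakCouplingRates.plaqCost0 r.ρ (1 : Fin 4) 2) n)`

## Assembly
Pure composition under the common binder prefix (glueG.lean, `lean check` rc 0): `closes hR hW hL hF
hX : XiPow := by intro G _ _ _ _ hG r;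
exact hX G hG r (hF G hG r (hR G hG r) (hW G hG r) (hL G hG r))` — all five items are binders of
`closes` and consumed (BC6: declared 6 /
in-cone 5 / the assembly item is the same implication as a Prop).

CLOSES_TARGET: closes rung R2xi of QuantumFields: Summit.QuantumFields.YangMills.Theorems.WeakCouplingRates.XiPow (D-0061; not the summit Statement) — the deciding theorem of this route concludes that registered leaf instead of the Statement decl `YangMills` (class rung: servable and labelled, never counted as concluding the summit Statement).

Rationale: WHY THIS LINE. RESTRICTED CLASS, DONE: for G = SU(2) the leaf `XiPowSU2` is proved in the tree
(`xiPowSU2_holds`, 2026-08-27: BOX `ColdBoxTwoPointFloorW_proof`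
p480280, BULK `BulkDominatesColdBoxW_proof` p490223, FLOOR p451030) — by an SU(2)-SPECIFIC
architecture: quaternion/gnomonic charts of
S³ (`WeakCouplingRatesColdBoxGnomonic`, `ColdBoxLargeFieldSU2`), the `tr 1 = 2` bookkeeping, and a
torus-versus-box domination inside
growing tori (BULK, ≈ 60 files). The route's own header says «the all-G leaf `XiPow` is a later
widening, not an item»; no listed route,
item or card targets `XiPow` (rg over Theses/: only that sentence). WIDENING LEVER (what this line
adds): state the whole argument on the
STATE SPACE 𝒢_inv(β) of translation-invariant DLR probability states on ℤ⁴, where nothing refers to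
a chart of G or to a volume:
(WITNESS) one constructible invariant state with the free-gluon floor — its natural proof is
Lie-algebra generic (exponential chart with
injectivity radius, Gaussian reference = dim G copies of lattice Maxwell, faithful-representation
coercivity N − Re tr r(u) ≥ c_r d(u,1)²
from injectivity + compactness, large-field suppression e^(−cβ·coercivity)), built as the Cesàro
average of a cold-boundary DLR limit
(rpCorr is super-additive under mixing of reflection- and translation-invariant states: the cross
term is Σ wᵢ(mᵢ − m̄)² ≥ 0);
(RIGIDITY) all invariant states agree on that one correlator to o(β^(−2)) — replacing BULK's
torus-vs-box comparison (which needs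
parity/chessboard care per torus family) by ONE β-asymptotic statement on ℤ⁴, provable either by
DLR-kernel decoupling (the collar
mechanism is already typed G-generically in the tree: `InfiniteVolume.MomentBounds6DLR`, `FBL6`) or
by positivity certificates over the
Schwinger–Dyson/loop equations, which hold for every compact G by Haar invariance (tree, SU(2)
instance: `isHaarShiftState_of_mem_ymGibbsMeasures`;
lattice bootstrap: Anderson–Kruczenski arXiv:1612.08140, Kazakov–Zheng arXiv:2203.11360 p.3 /
arXiv:2404.16925, Guo–Li–Yang–Zheng
arXiv:2502.14421). Imported areas: Gibbs-state convex analysis (Georgii 2011 Thm 4.17 / 7.7),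
compact-Lie structure theory (Sepanski 2007,
Bröcker–tom Dieck 1985) for the chart-free coercivity, convex duality / SOS certificates for
rigidity. The negatives index (7 entries)
has nothing on 𝒢_inv(β) correlators; the HyperbolicToTorusR negative lemma
(`transInv_unique_of_extremal`: «all invariant states
extremal» = uniqueness) is respected — RIGIDITY is a quantitative window on ONE correlator, not
purity or uniqueness of the phase.

RANKED CRUXES. #2 CorrelatorRigidityG (crux) — RIGIDITY for every compact simple G and faithful
unitary lattice representation r — there are A > 0, a > 2, C, q, β₀ such that for β ≥ β₀ any two
translation-invariant DLR probability states μ, ν of the 4-d Wilson theory satisfy |rpCorr μ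
(plaqCost0 r.ρ 1 2) n − rpCorr ν (plaqCost0 r.ρ 1 2) n| ≤ C n^q β^(−a) for every 1 ≤ n ≤ 2β^A.
[difficulty: open-problem] (why it might fail: two coexisting invariant phases at large β
(centre-vortex / monopole condensates for G with non-trivial centre or π₁ of G/Z) whose plaquette
statistics differ at order β^(−a/2); or no β-uniform decoupling/certificate short of full
weak-coupling uniqueness (barrier UVStabilityNonUniqueness).) [arXiv:2203.11360, arXiv:2404.16925,
arXiv:1612.08140, arXiv:2502.14421, Georgii2011]
#3 WitnessStateFloorG (crux) — WITNESS for every compact simple G and r — there are A, κ > 0, p, β₀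
such that for β ≥ β₀ and every 1 ≤ n ≤ 2β^A some translation-invariant DLR probability state ν has κ
β^(−2) n^(−p) ≤ rpCorr ν (plaqCost0 r.ρ 1 2) n (the Lie-algebra-generic cold state: dim G
lattice-Maxwell copies at leading order). [difficulty: XL] (why it might fail: the SU(2) cold-box
expansion used global charts of S³; for general G the large-field region includes u far from 1 in G
with r(u) near-degenerate directions only excluded by coercivity, and the Cesàro/DLR-limit
bookkeeping must keep the floor uniform in n ≤ 2β^A.) [arXiv:1803.01950, Balaban1985AveragingYM,
Sepanski2007, OsterwalderSeiler1978]
#9 LimitPointsAreInvariantDLRG (support) — for every G, r, β, every infinite-volume torus limit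
point (any subsequence of sides L_k + 1) is a DLR state for `ymSpecification r.ρ β` and is
ℤ⁴-translation invariant (Georgii Thm 4.17; tree fact
`mem_ymGibbsMeasures_of_mem_infiniteVolumeLimitPoints`, SU(2) twins
`isHaarShiftState_of_mem_infiniteVolumeLimitPoints`,
`classBInvariances_of_mem_infiniteVolumeLimitPoints`). [difficulty: M] [Georgii2011,
arXiv:1803.01950, SeilerLNP1982]
#9 FloorOfRigidityAndWitnessG (support) — arithmetic glue, per (G, r) — RIGIDITY (A, C, q, a) +
WITNESS (A′, κ, p) + limit points ∈ 𝒢_inv(β) ⇒ every limit point has the floor (κ/2) β^(−2) n^(−p)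
at all 1 ≤ n ≤ 2β^(A″), A″ = min(A, A′, (a − 2)/(2(p + q))) (so that C (2β^(A″))^q β^(−a) ≤ κ
β^(−2)/(2 (2β^(A″))^p) for large β). [difficulty: M] [arXiv:1803.01950]
#9 XiPowOfLimitPointFloorG (support) — kernel transfer in WCR currency, per (G, r) — a floor κ
β^(−2) n^(−p) at all 1 ≤ n ≤ 2β^A for every limit point ⇒ ∃ ε > 0, MassGapPowerDecayOf 4 r.ρ ε (ε =
A/2): `HasRPTimeGap.le_log_div` with F = plaqCost0 r.ρ 1 2 (`IsPosTimeObs` by `plaqCost0_support`,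
continuity/boundedness by `continuous_bounded_plaqCost0 r.continuous`), V = (2N)², t = ⌈β^A⌉₊, δ = κ
β^(−2) t^(−p), then log(V/δ)/t ≤ β^(−A/2) eventually (`massGapPowerDecayOf_of_powerLawCorr` is the
model). [difficulty: M] [arXiv:1803.01950, OsterwalderSeiler1978]

TWO-LAYER PLAN. CorrelatorRigidityG ⇐ LoopValueRigidity (all states agree on every single Wilson
loop of extent ≤ 2β^A to O(|w|^q β^(−a)); linear
functionals, the natural SDP/SOS certificate target) → CharacterTransfer (product of two traces =
sum over r ⊗ r-isotypic loops; for SU(2) the Mandelstam identity `trace_mul_trace_su_two`) →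
CorrelatorRigidityG. WitnessStateFloorG ⇐
ColdStateFloor (the Cesàro-averaged cold-boundary DLR limit has the floor; concavity of covariance
under averaging) → its DLR /
invariance bookkeeping. PROVED RUNG (BC5 witness of weakness): the whole chain for G = SU(2)
(`xiPowSU2_holds`; there BULK plays RIGIDITY's role). First new rung (plan-only):
FixedSeparationRigidityG — CorrelatorRigidityG at ONE separation n = 1 with a = 3
(a β-uniform certificate family of fixed level), the statement the I4 engine can calibrate now.

KILL CRITERIA. Refutation of CorrelatorRigidityG for ANY compact simple G (two invariant DLR states
at arbitrarily large β whose separation-1 connected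
plaquette correlators differ at order β^(−2)) closes the route (`refuted:CorrelatorRigidityG`); a
proof that WitnessStateFloorG needs
volume-uniform cluster control equivalent to a G-generic BULK forces a pivot to «port WCR's BOX ∧
BULK to exponential charts» (then this
route is superseded by that port); `XiPow` proved by a direct port of route WeakCouplingRates moots
the line (shared leaf). Administrative
kill: if `XiPow` is not registered as an alt-closer the route cannot be served (it stays a card +
this certified file).

NOT DECOMPOSED YET. The chart-free coercivity lemma (N − Re tr r(u) ≥ c_r d(u,1)² on G) and the
exponential-chart Gaussian reference (dim G Maxwell copies)
inside WITNESS; the certificate level / collar radius inside RIGIDITY and which positivity families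
it needs; the construction of the
witness state (cold-boundary limit + Cesàro averaging); constants a, q, p (physically a ≥ 3, p = 8);
the r-dependence of κ (quadratic
Casimir of r).

CHEAPEST FALSIFIER. Run the I4 lattice-bootstrap engine (pub-gaugeboot: SU(2), D = 4, loop equations
`loopEquation_su_two_loops_of_dispBound` + Gram +
site/link RP blocks) at tree couplings β ∈ (4, 8, 16) with L_max ∈ (8, 12, 16) on TWO objectives:
the plaquette window width w(β, Λ)
and the window of the separation-1 connected correlator ½(u(P·t·P·t⁻¹) + u(P·t·P⁻¹·t⁻¹)) − u_P·ū_P.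
The line dies if w(β, Λ) does
not shrink faster than β^(−1) as Λ grows at fixed large β (RIGIDITY needs window o(β^(−1)) on means
and o(β^(−2)) on the connected
correlator); it is calibrated if β²·(lower window edge of the connected correlator) stabilises near
the free-gluon value. Printed
evidence so far is one-sided: KZ's upper bound hugs 3-loop PT at L_max = 16, the lower bound does
not (arXiv:2203.11360 p.3, Fig. 2).
Not run here (SDP of that size exceeds the seat's 4 cores; it is the instrument row I4's standing
engine). Structural falsifier for the widening: a compact simple G and β_k → ∞ with TWO invariant
DLR states differing at O(β_k^(−2)) on the plaquette (none known in d = 4).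

NUMBERS. Free two-gluon exchange: β²·Cov(c_0, c_n) ≍ n^(−8) at separation n (WCR Currency docstring
of `PolySeparationPlaquetteFloor`); KZ
SU(∞) D=4: L_max = 16 upper bound within plotting accuracy of 3-loop PT for λ below the transition
λ_c ≈ 1.4 (arXiv:2203.11360 p.3);
I4 census: 433 exact-rational SDP certificates, e.g. SU(2) D=4 β_std = 1: ū_P ∈ [0.2221, 0.6333]
(LADDER-YM row I4).

DEFINITION REQUESTS. None: all items are typed over tree declarations (`LatticeRep`,
`IsCompactSimpleLieGroup`, `ymGibbsMeasures`, `IsZdTranslationInvariant`,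
`infiniteVolumeLimitPoints`, `rpCorr`, `plaqCost0`, `MassGapPowerDecayOf`, `XiPow`).

Novelty: Searches (2026-08-27): lit search --hybrid "lattice Yang-Mills bootstrap loop equations positivity
semidefinite bounds plaquette" (8
docs: Montvay–Münster, Creutz, Greensite, Rivasseau, Gambini–Pullin …, no rigidity statement); lit
search "Kazakov Zheng bootstrap
lattice" (6 local: arXiv:2203.11360, 2404.16925, 2502.14421, 2507.02386, 2309.04472, 2505.16585;
remote 6); lit vsearch "all
translation invariant Gibbs states of 4d lattice gauge theory at weak coupling have the same
plaquette expectation…" (8 books, none on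
point); lit galaxy search "lattice bootstrap|loop equation bootstrap|Migdal-Makeenko" --star all (9
rows, noise) and "uniqueness of
the Gibbs state|translation invariant Gibbs states|weak coupling expansion" --star pdf (8 rows,
noise); ledger negatives --problem
QuantumFields (7, none related); tree: Theses/WeakCouplingRates.lean, GaugeBoot/ClassB*.lean,
HyperbolicToTorusR/Negative.
Tree search for the target: `rg XiPow Theses/` — only the WeakCouplingRates header sentence «the
all-G leaf XiPow … is a later widening, not an item»; no route, item or card on `XiPow`; `ledger
route closers`: R2xi = XiPowSU2 (proved 2026-08-27, `xiPowSU2_holds`).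
Neighbouring D-0145 lines on the same leaf (all born 2026-08-27 20:38–20:48Z, read):
route-QuantumFields-ColdBoxAllGroups (ym-idea-2) and route-QuantumFields-AllGroupsColdBox
(ym-idea-5) = ports of WCR's BOX_G ∧ BULK_G (finite volumes, exponential-chart package);
route-QuantumFields-SoftLoopVariational (ym-idea-5) = one col  [refs: 2203.11360, 2404.16925, 1612.08140]

Barriers (technique_class: dlr-state-space, cluster-expansion, bootstrap-positivity): - technique_class: dlr-state-space, cluster-expansion, bootstrap-positivity
- Literature.Barriers.QuantumFields.FixedCouplingUltralocality: outside — the barrier kills fixed-β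
/ bounded-ξ statements as summit evidence; this line's statements are β → ∞ asymptotics (ξ ≥ β^ε)
and claim no continuum limit; the certificates must be β-uniform families, which is exactly crux
CorrelatorRigidity.
- Literature.Barriers.QuantumFields.PerturbativeInvisibility: outside — the barrier says the gap (a
LOWER bound on m, scale e^(−cβ)) is invisible to any finite order in g; the leaf is an UPPER bound
on m whose content is precisely that correlations of perturbative size β^(−2) n^(−8) persist, so
perturbative visibility is the resource, not the obstacle.
- Literature.Barriers.QuantumFields.UVStabilityNonUniqueness: it does, partly — stability bounds
give existence not uniqueness, and RIGIDITY is a near-uniqueness window; the bet is that positivity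
+ exact loop equations (an over-determined linear system on loop values), not stability bounds, pin
ONE local correlator to O(β^(−a)) without pinning the state.
- Literature.Barriers.QuantumFields.RegularisationDichotomy: not applicable — one lattice
regularisation, no Euclidean invariance or continuum limit is claimed.
- Literature.Barriers.QuantumFields.AbelianDeconfinementD4: outside — the barrier blocks group-blind
CONFINEMENT / clustering arguments (they would also apply to U(1)₄, which deconfines); this line
proves an ANTI-gap statement (m ≤ β^(

History (route lifecycle, newest last):
- 2026-08-27T21:36:02Z · closes_target -> closes rung R2xi of QuantumFields: Summit.QuantumFields.YangMills.Theorems.WeakCouplingRates.XiPow (D-0061; not the summit Statement) (planner-ym-idea-1-g0-0)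
- 2026-08-28T02:14:25Z · CLOSED superseded — superseded:route-QuantumFields-ColdBoxAllGroups (planner-ym-idea-1-g3-0)

sub-problem: YangMills · status: closed(superseded) · opened planner-ym-idea-1-g0-0 2026-08-27T20:51:21Z · rev 2 · ledger route-QuantumFields-XiPowWidening
GENERATED by the gate from the ledger (D-0016/17). Provers cite these decls: `theorem foo : Summit.QuantumFields.YangMills.Theses.XiPowWidening.<Decl> := …` in Summits/QuantumFields/YangMills/Theorems/<Name>.lean.
-/

namespace Summit.QuantumFields.YangMills.Theses.XiPowWidening

open scoped BigOperators Topology Manifold Classical MeasureTheory ProbabilityTheory Matrix InnerProductSpace ComplexConjugate ContinuousMap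
open Filter Set Function TopologicalSpace MeasureTheory

attribute [summit_statement] _root_.YangMills
attribute [summit_statement] _root_.Summit.QuantumFields.YangMills.Theorems.WeakCouplingRates.XiPow

/-- item stmt-QuantumFields-22466 · crux · rank 2 · closed · moot by None · by planner
why it might fail: two coexisting invariant phases at large β (centre-vortex / monopole condensates for G with non-trivial centre or π₁ of G/Z) whose plaquette statistics differ at order β^(−a/2); or no β-uniform decoupling/certificate short of full weak-coupling uniqueness (barrier UVStabilityNonUniqueness).
sources: arXiv:2203.11360, arXiv:2404.16925, arXiv:1612.08140, arXiv:2502.14421, Georgii2011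
[crux] RIGIDITY for every compact simple G and faithful unitary lattice representation r — there are
A > 0, a > 2, C, q, β₀ such that for β ≥ β₀ any two translation-invariant DLR probability states μ,
ν of the 4-d Wilson theory satisfy |rpCorr μ (plaqCost0 r.ρ 1 2) n − rpCorr ν (plaqCost0 r.ρ 1 2) n|
≤ C n^q β^(−a) for every 1 ≤ n ≤ 2β^A. [difficulty: open-problem] -/
@[route_item "route-QuantumFields-XiPowWidening", crux]
def CorrelatorRigidityG : Prop :=
  ∀ (G : Type) [Group G] [TopologicalSpace G] [IsTopologicalGroup G] [CompactSpace G], Literature.MathematicalPhysics.QuantumFieldTheory.IsCompactSimpleLieGroup G → letI : MeasurableSpace G := borel G; haveI : BorelSpace G := ⟨rfl⟩; ∀ r : Literature.MathematicalPhysics.QuantumFieldTheory.LatticeRep G, ∃ A C β₀ a : ℝ, ∃ q : ℕ, 0 < A ∧ 2 < a ∧ ∀ β : ℝ, β₀ ≤ β → ∀ μ ν : MeasureTheory.Measure (Literature.MathematicalPhysics.QuantumLattice.LGConfig 4 G), μ ∈ Literature.MathematicalPhysics.QuantumLattice.ymGibbsMeasures (d := 4) r.ρ β → ν ∈ Literature.MathematicalPhysics.QuantumLattice.ymGibbsMeasures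 (d := 4) r.ρ β → MeasureTheory.IsProbabilityMeasure μ → MeasureTheory.IsProbabilityMeasure ν → Literature.MathematicalPhysics.QuantumLattice.IsZdTranslationInvariant μ → Literature.MathematicalPhysics.QuantumLattice.IsZdTranslationInvariant ν → ∀ n : ℕ, 1 ≤ n → (n : ℝ) ≤ 2 * β ^ A → |Summit.QuantumFields.YangMills.Theorems.WeakCouplingRates.rpCorr μ (Summit.QuantumFields.YangMills.Theorems.WeakCouplingRates.plaqCost0 r.ρ (1 : Fin 4) 2) n - Summit.QuantumFields.YangMills.Theorems.WeakCouplingRates.rpCorr ν (Summit.QuantumFields.YangMills.Theorems.WeakCouplingRates.plaqCost0 r.ρ (1 : Fin 4) 2) n| ≤ C * (n : ℝ) ^ q * β ^ (-a)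

/-- item stmt-QuantumFields-22467 · crux · rank 3 · closed · moot by None · by planner
why it might fail: the SU(2) cold-box expansion used global charts of S³; for general G the large-field region includes u far from 1 in G with r(u) near-degenerate directions only excluded by coercivity, and the Cesàro/DLR-limit bookkeeping must keep the floor uniform in n ≤ 2β^A.
sources: arXiv:1803.01950, Balaban1985AveragingYM, Sepanski2007, OsterwalderSeiler1978
[crux] WITNESS for every compact simple G and r — there are A, κ > 0, p, β₀ such that for β ≥ β₀ and
every 1 ≤ n ≤ 2β^A some translation-invariant DLR probability state ν has κ β^(−2) n^(−p) ≤ rpCorr ν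
(plaqCost0 r.ρ 1 2) n (the Lie-algebra-generic cold state: dim G lattice-Maxwell copies at leading
order). [difficulty: XL] -/
@[route_item "route-QuantumFields-XiPowWidening", crux]
def WitnessStateFloorG : Prop :=
  ∀ (G : Type) [Group G] [TopologicalSpace G] [IsTopologicalGroup G] [CompactSpace G], Literature.MathematicalPhysics.QuantumFieldTheory.IsCompactSimpleLieGroup G → letI : MeasurableSpace G := borel G; haveI : BorelSpace G := ⟨rfl⟩; ∀ r : Literature.MathematicalPhysics.QuantumFieldTheory.LatticeRep G, ∃ A κ β₀ : ℝ, ∃ p : ℕ, 0 < A ∧ 0 < κ ∧ ∀ β : ℝ, β₀ ≤ β → ∀ n : ℕ, 1 ≤ n → (n : ℝ) ≤ 2 * β ^ A → ∃ ν : MeasureTheory.Measure (Literature.MathematicalPhysics.QuantumLattice.LGConfig 4 G), ν ∈ Literature.MathematicalPhysics.QuantumLattice.ymGibbsMeasures (d := 4) r.ρ β ∧ MeasureTheory.IsProbabilityMeasure ν ∧ Literature.MathematicalPhysics.QuantumLattice.IsZdTranslationInvariant ν ∧ κ * β ^ (-(2 : ℝ)) / (n : ℝ) ^ p ≤ Summit.QuantumFields.YangMills.Theorems.WeakCouplingRates.rpCorr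 ν (Summit.QuantumFields.YangMills.Theorems.WeakCouplingRates.plaqCost0 r.ρ (1 : Fin 4) 2) n

/-- item stmt-QuantumFields-22468 · support · rank 9 · closed · proved by Summit.QuantumFields.YangMills.Theorems.xiPowWidening_limitPointsAreInvariantDLRG_proof (prover) · by planner
sources: Georgii2011, arXiv:1803.01950, SeilerLNP1982
[support] for every G, r, β, every infinite-volume torus limit point (any subsequence of sides L_k +
1) is a DLR state for `ymSpecification r.ρ β` and is ℤ⁴-translation invariant (Georgii Thm 4.17;
tree fact `mem_ymGibbsMeasures_of_mem_infiniteVolumeLimitPoints`, SU(2) twins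
`isHaarShiftState_of_mem_infiniteVolumeLimitPoints`,
`classBInvariances_of_mem_infiniteVolumeLimitPoints`). [difficulty: M] -/
@[route_item "route-QuantumFields-XiPowWidening", crux]
def LimitPointsAreInvariantDLRG : Prop :=
  ∀ (G : Type) [Group G] [TopologicalSpace G] [IsTopologicalGroup G] [CompactSpace G], Literature.MathematicalPhysics.QuantumFieldTheory.IsCompactSimpleLieGroup G → letI : MeasurableSpace G := borel G; haveI : BorelSpace G := ⟨rfl⟩; ∀ r : Literature.MathematicalPhysics.QuantumFieldTheory.LatticeRep G, ∀ β : ℝ, ∀ μ ∈ Literature.MathematicalPhysics.QuantumLattice.infiniteVolumeLimitPoints (d := 4) r.ρ β, μ ∈ Literature.MathematicalPhysics.QuantumLattice.ymGibbsMeasures (d := 4) r.ρ β ∧ Literature.MathematicalPhysics.QuantumLattice.IsZdTranslationInvariant μ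

-- `LimitPointsAreInvariantDLRG` holds: proved by `Summit.QuantumFields.YangMills.Theorems.xiPowWidening_limitPointsAreInvariantDLRG_proof` (its module imports this route file, so no `_holds` link can be stated here).

/-- item stmt-QuantumFields-22469 · support · rank 9 · closed · proved by Summit.QuantumFields.YangMills.Theorems.xiPowWidening_floorOfRigidityAndWitnessG_proof (prover) · by planner
sources: arXiv:1803.01950
[support] arithmetic glue, per (G, r) — RIGIDITY (A, C, q, a) + WITNESS (A′, κ, p) + limit points ∈
𝒢_inv(β) ⇒ every limit point has the floor (κ/2) β^(−2) n^(−p) at all 1 ≤ n ≤ 2β^(A″), A″ = min(A,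
A′, (a − 2)/(2(p + q))) (so that C (2β^(A″))^q β^(−a) ≤ κ β^(−2)/(2 (2β^(A″))^p) for large β).
[difficulty: M] -/
@[route_item "route-QuantumFields-XiPowWidening", crux]
def FloorOfRigidityAndWitnessG : Prop :=
  ∀ (G : Type) [Group G] [TopologicalSpace G] [IsTopologicalGroup G] [CompactSpace G], Literature.MathematicalPhysics.QuantumFieldTheory.IsCompactSimpleLieGroup G → letI : MeasurableSpace G := borel G; haveI : BorelSpace G := ⟨rfl⟩; ∀ r : Literature.MathematicalPhysics.QuantumFieldTheory.LatticeRep G, (∃ A C β₀ a : ℝ, ∃ q : ℕ, 0 < A ∧ 2 < a ∧ ∀ β : ℝ, β₀ ≤ β → ∀ μ ν : MeasureTheory.Measure (Literature.MathematicalPhysics.QuantumLattice.LGConfig 4 G), μ ∈ Literature.MathematicalPhysics.QuantumLattice.ymGibbsMeasures (d := 4) r.ρ β → ν ∈ Literature.MathematicalPhysics.QuantumLattice.ymGibbsMeasures (d := 4) r.ρ β → MeasureTheory.IsProbabilityMeasure μ → MeasureTheory.IsProbabilityMeasure ν → Literature.MathematicalPhysics.QuantumLattice.IsZdTranslationInvariant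 μ → Literature.MathematicalPhysics.QuantumLattice.IsZdTranslationInvariant ν → ∀ n : ℕ, 1 ≤ n → (n : ℝ) ≤ 2 * β ^ A → |Summit.QuantumFields.YangMills.Theorems.WeakCouplingRates.rpCorr μ (Summit.QuantumFields.YangMills.Theorems.WeakCouplingRates.plaqCost0 r.ρ (1 : Fin 4) 2) n - Summit.QuantumFields.YangMills.Theorems.WeakCouplingRates.rpCorr ν (Summit.QuantumFields.YangMills.Theorems.WeakCouplingRates.plaqCost0 r.ρ (1 : Fin 4) 2) n| ≤ C * (n : ℝ) ^ q * β ^ (-a)) → (∃ A κ β₀ : ℝ, ∃ p : ℕ, 0 < A ∧ 0 < κ ∧ ∀ β : ℝ, β₀ ≤ β → ∀ n : ℕ, 1 ≤ n → (n : ℝ) ≤ 2 * β ^ A → ∃ ν : MeasureTheory.Measure (Literature.MathematicalPhysics.QuantumLattice.LGConfig 4 G), ν ∈ Literature.MathematicalPhysics.QuantumLattice.ymGibbsMeasures (d := 4) r.ρ β ∧ MeasureTheory.IsProbabilityMeasure ν ∧ Literature.MathematicalPhysics.QuantumLattice.IsZdTranslationInvariant ν ∧ κ * β ^ (-(2 :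 ℝ)) / (n : ℝ) ^ p ≤ Summit.QuantumFields.YangMills.Theorems.WeakCouplingRates.rpCorr ν (Summit.QuantumFields.YangMills.Theorems.WeakCouplingRates.plaqCost0 r.ρ (1 : Fin 4) 2) n) → (∀ β : ℝ, ∀ μ ∈ Literature.MathematicalPhysics.QuantumLattice.infiniteVolumeLimitPoints (d := 4) r.ρ β, μ ∈ Literature.MathematicalPhysics.QuantumLattice.ymGibbsMeasures (d := 4) r.ρ β ∧ Literature.MathematicalPhysics.QuantumLattice.IsZdTranslationInvariant μ) → ∃ A κ β₀ : ℝ, ∃ p : ℕ, 0 < A ∧ 0 < κ ∧ ∀ β : ℝ, β₀ ≤ β → ∀ μ ∈ Literature.MathematicalPhysics.QuantumLattice.infiniteVolumeLimitPoints (d := 4) r.ρ β, ∀ n : ℕ, 1 ≤ n → (n : ℝ) ≤ 2 * β ^ A → κ * β ^ (-(2 : ℝ)) / (n : ℝ) ^ p ≤ Summit.QuantumFields.YangMills.Theorems.WeakCouplingRates.rpCorr μ (Summit.QuantumFields.YangMills.Theorems.WeakCouplingRates.plaqCost0 r.ρ (1 : Fin 4) 2) n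

-- `FloorOfRigidityAndWitnessG` holds: proved by `Summit.QuantumFields.YangMills.Theorems.xiPowWidening_floorOfRigidityAndWitnessG_proof` (its module imports this route file, so no `_holds` link can be stated here).

/-- item stmt-QuantumFields-22470 · support · rank 9 · closed · proved by Summit.QuantumFields.YangMills.Theorems.xiPowWidening_xiPowOfLimitPointFloorG_proof (prover) · by planner
sources: arXiv:1803.01950, OsterwalderSeiler1978
[support] kernel transfer in WCR currency, per (G, r) — a floor κ β^(−2) n^(−p) at all 1 ≤ n ≤ 2β^A
for every limit point ⇒ ∃ ε > 0, MassGapPowerDecayOf 4 r.ρ ε (ε = A/2): `HasRPTimeGap.le_log_div`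
with F = plaqCost0 r.ρ 1 2 (`IsPosTimeObs` by `plaqCost0_support`, continuity/boundedness by
`continuous_bounded_plaqCost0 r.continuous`), V = (2N)², t = ⌈β^A⌉₊, δ = κ β^(−2) t^(−p), then
log(V/δ)/t ≤ β^(−A/2) eventually (`massGapPowerDecayOf_of_powerLawCorr` is the model). [difficulty:
M] -/
@[route_item "route-QuantumFields-XiPowWidening", crux]
def XiPowOfLimitPointFloorG : Prop :=
  ∀ (G : Type) [Group G] [TopologicalSpace G] [IsTopologicalGroup G] [CompactSpace G], Literature.MathematicalPhysics.QuantumFieldTheory.IsCompactSimpleLieGroup G → letI : MeasurableSpace G := borel G; haveI : BorelSpace G := ⟨rfl⟩; ∀ r : Literature.MathematicalPhysics.QuantumFieldTheory.LatticeRep G, (∃ A κ β₀ : ℝ, ∃ p : ℕ, 0 < A ∧ 0 < κ ∧ ∀ β : ℝ, β₀ ≤ β → ∀ μ ∈ Literature.MathematicalPhysics.QuantumLattice.infiniteVolumeLimitPoints (d := 4) r.ρ β, ∀ n : ℕ, 1 ≤ n → (n : ℝ) ≤ 2 * β ^ A → κ * β ^ (-(2 : ℝ)) / (n : ℝ) ^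 p ≤ Summit.QuantumFields.YangMills.Theorems.WeakCouplingRates.rpCorr μ (Summit.QuantumFields.YangMills.Theorems.WeakCouplingRates.plaqCost0 r.ρ (1 : Fin 4) 2) n) → ∃ ε : ℝ, 0 < ε ∧ Summit.QuantumFields.YangMills.Theorems.WeakCouplingRates.MassGapPowerDecayOf 4 r.ρ ε

-- `XiPowOfLimitPointFloorG` holds: proved by `Summit.QuantumFields.YangMills.Theorems.xiPowWidening_xiPowOfLimitPointFloorG_proof` (its module imports this route file, so no `_holds` link can be stated here).

/-- item stmt-QuantumFields-22471 · aside (kind.auto-crux: conjecture-grade) · rank 1 · closed · proved by Summit.QuantumFields.YangMills.Theorems.xiPowWidening_assembly_proof (prover) · by planner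
why it might fail: auto-crux — conjecture-grade statement (statement references the registered conjecture Summit.QuantumFields.YangMills.Theorems.WeakCouplingRates.XiPow); it is open, so it may simply be false
sources: arXiv:1803.01950
[assembly] CorrelatorRigidityG → WitnessStateFloorG → LimitPointsAreInvariantDLRG →
FloorOfRigidityAndWitnessG → XiPowOfLimitPointFloorG → XiPow (the all-groups leaf). -/
@[route_item "route-QuantumFields-XiPowWidening"]
def Assembly : Prop :=
  CorrelatorRigidityG → WitnessStateFloorG → LimitPointsAreInvariantDLRG → FloorOfRigidityAndWitnessG → XiPowOfLimitPointFloorG → Summit.QuantumFields.YangMills.Theorems.WeakCouplingRates.XiPow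

-- `Assembly` holds: proved by `Summit.QuantumFields.YangMills.Theorems.xiPowWidening_assembly_proof` (its module imports this route file, so no `_holds` link can be stated here).

/-! D-0027 §2.1 — DECIDING THEOREM (planner-authored via `route open/edit --closes-file`; by planner-ym-idea-1-g0-0 2026-08-27T21:36:02Z) — ARCHIVED: route closed (superseded) 2026-08-28T02:14:24Z; kept so importers keep building:
its hypotheses are this route's items and its conclusion the registered leaf `Summit.QuantumFields.YangMills.Theorems.WeakCouplingRates.XiPow` (rung R2xi, D-0061) (glue_lint), and it elaborates with this file. -/

@[closes "route-QuantumFields-XiPowWidening"] theorem closes (hR : CorrelatorRigidityG) (hW : WitnessStateFloorG) (hL : LimitPointsAreInvariantDLRG)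
    (hF : FloorOfRigidityAndWitnessG) (hX : XiPowOfLimitPointFloorG) :
    Summit.QuantumFields.YangMills.Theorems.WeakCouplingRates.XiPow := by
  intro G _ _ _ _ hG r
  exact hX G hG r (hF G hG r (hR G hG r) (hW G hG r) (hL G hG r))

end Summit.QuantumFields.YangMills.Theses.XiPowWidening
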